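import Summits.PneNP.PneNP.Theorems.ReslinSizeFromWidthQuadraticSemantic

/-!
# PneNP / ReslinSizeFromWidth — quadratic size–width law, part 2b: premise chains

Helper file for the quadratic truncation of crux `ResLinSizeFromWidth` (stmt-PneNP-18932).
The last-occurrence tail `ltail N L` of a line, STEPS (a nonempty line in the tail whose equations
exceed those of the source by at most one dimension — every premise actually needed is reached by
a step) and REACHABILITY from the root; a reachable line ends a CHAIN of steps with strictly
shrinking tails, hence pairwise distinct lines — the path fed to the common-subspace lemma.
-/

namespace Summit.PneNP.PneNP.Theorems

-- `Summit.PneNP.PneNP` repeats a path component by design (summit = sub-problem); silence the linter.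
set_option linter.dupNamespace false

namespace ResLinSW

section Semantic

open Module Submodule
open scoped Pointwise

variable {V : Type*} [Fintype V]

/-! ### Last-occurrence tails, steps and reachability -/

open Classical in
/-- The tail of `L` after the LAST occurrence of `N` (deepest, i.e. earliest-derived, copy). -/
noncomputable def ltail (N : Set (V → ZMod 2)) : List (Set (V → ZMod 2)) → List (Set (V → ZMod 2))
  | [] => []
  | _ :: L => if N ∈ L then ltail N L else L

omit [Fintype V] in
/-- `N :: ltail N L` is a suffix of `L` when `N ∈ L`. -/
theorem cons_ltail_suffix {N : Set (V → ZMod 2)} :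
    ∀ {L : List (Set (V → ZMod 2))}, N ∈ L → N :: ltail N L <:+ L
  | [], h => absurd h List.not_mem_nil
  | M :: L, h => by
    classical
    simp only [ltail]
    split_ifs with hL
    · exact (cons_ltail_suffix hL).trans (List.suffix_cons M L)
    · have : N = M := by
        rcases List.mem_cons.1 h with h | h
        · exact h
        · exact absurd h hL
      subst this
      exact List.suffix_refl _

omit [Fintype V] in
/-- The last-occurrence tail is a strict suffix: it is shorter than the list. -/
theorem length_ltail_lt {N : Set (V → ZMod 2)} {L : List (Set (V → ZMod 2))} (h : N ∈ L) :
    (ltail N L).length < L.length := by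
  have := (cons_ltail_suffix h).length_le
  simp only [List.length_cons] at this
  omega

omit [Fintype V] in
/-- Members of the tail are members of the list. -/
theorem mem_of_mem_ltail {N P : Set (V → ZMod 2)} :
    ∀ {L : List (Set (V → ZMod 2))}, P ∈ ltail N L → P ∈ L
  | [], h => by simp [ltail] at h
  | M :: L, h => by
    classical
    simp only [ltail] at h
    split_ifs at h with hL
    · exact List.mem_cons_of_mem M (mem_of_mem_ltail h)
    · exact List.mem_cons_of_mem M h

omit [Fintype V] in
/-- Tails shrink along the list: the tail of a member of `ltail N L` is a shorter tail. -/
theorem length_ltail_lt_of_mem_ltail {N P : Set (V → ZMod 2)} :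
    ∀ {L : List (Set (V → ZMod 2))}, P ∈ ltail N L → (ltail P L).length < (ltail N L).length
  | [], h => by simp [ltail] at h
  | M :: L, h => by
    classical
    simp only [ltail] at h ⊢
    by_cases hNL : N ∈ L
    · rw [if_pos hNL] at h ⊢
      have hPL : P ∈ L := mem_of_mem_ltail h
      rw [if_pos hPL]
      exact length_ltail_lt_of_mem_ltail h
    · rw [if_neg hNL] at h ⊢
      rw [if_pos h]
      exact length_ltail_lt h

/-- In a derivation every line is justified by its last-occurrence tail. -/
theorem IsDeriv.justified_ltail {𝒞 : Set (Set (V → ZMod 2))} {L : List (Set (V → ZMod 2))}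
    (hL : IsDeriv 𝒞 L) {N : Set (V → ZMod 2)} (hN : N ∈ L) : Justified 𝒞 (ltail N L) N :=
  hL.justified_of_suffix (cons_ltail_suffix hN)

/-- A STEP from line `N` to line `P`: `P` is a nonempty member of the last-occurrence tail of `N`
whose equations exceed those of `N` by at most one dimension. -/
structure Step (L : List (Set (V → ZMod 2))) (N P : Set (V → ZMod 2)) : Prop where
  /-- the target is derived before (the last copy of) the source -/
  mem : P ∈ ltail N L
  /-- the target is nonempty -/
  ne : P.Nonempty
  /-- the equations grow by at most one along the step -/
  le : ∃ e : Eqn V, W P ≤ W N ⊔ (ZMod 2) ∙ e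

/-- REACHABILITY from `A` along steps. -/
inductive Reach (L : List (Set (V → ZMod 2))) (A : Set (V → ZMod 2)) : Set (V → ZMod 2) → Prop
  /-- the root is reachable -/
  | root : Reach L A A
  /-- a step from a reachable line reaches its target -/
  | step {N P : Set (V → ZMod 2)} (hN : Reach L A N) (hs : Step L N P) : Reach L A P

/-- Reachable lines are nonempty (if the root is). -/
theorem Reach.nonempty {L : List (Set (V → ZMod 2))} {A N : Set (V → ZMod 2)} (h : Reach L A N)
    (hA : A.Nonempty) : N.Nonempty := by
  induction h with
  | root => exact hA
  | step _ hs _ => exact hs.ne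

/-- Reachable lines are lines (if the root is). -/
theorem Reach.mem {L : List (Set (V → ZMod 2))} {A N : Set (V → ZMod 2)} (h : Reach L A N)
    (hA : A ∈ L) : N ∈ L := by
  induction h with
  | root => exact hA
  | step _ hs _ => exact mem_of_mem_ltail hs.mem

/-- A reachable line is the end of a CHAIN of steps from the root: `c 0 = A`, `c m = N`,
consecutive steps, hence `W (c (i+1)) ≤ W (c i) + ⟨e i⟩` and strictly decreasing tails. -/
theorem Reach.exists_chain {L : List (Set (V → ZMod 2))} {A N : Set (V → ZMod 2)}
    (h : Reach L A N) : ∃ (m : ℕ) (c : ℕ → Set (V → ZMod 2)), c 0 = A ∧ c m = N ∧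
      (∀ i < m, Step L (c i) (c (i + 1))) ∧ ∀ i ≤ m, Reach L A (c i) := by
  induction h with
  | root => exact ⟨0, fun _ => A, rfl, rfl, fun i hi => absurd hi (Nat.not_lt_zero i),
      fun i _ => Reach.root⟩
  | @step N P hN hs ih =>
    obtain ⟨m, c, h0, hm, hstep, hreach⟩ := ih
    refine ⟨m + 1, fun i => if i ≤ m then c i else P, by simp [h0], by simp, ?_, ?_⟩
    · intro i hi
      dsimp only
      by_cases him : i < m
      · rw [if_pos him.le, if_pos (by omega)]
        exact hstep i him
      · have : i = m := by omega
        subst this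
        rw [if_pos le_rfl, if_neg (by omega), hm]
        exact hs
    · intro i hi
      dsimp only
      by_cases him : i ≤ m
      · rw [if_pos him]; exact hreach i him
      · rw [if_neg him]; exact Reach.step hN hs

/-- Along a chain of steps the last-occurrence tails strictly shrink, so the chain is injective. -/
theorem chain_injOn {L : List (Set (V → ZMod 2))} {m : ℕ} {c : ℕ → Set (V → ZMod 2)}
    (hstep : ∀ i < m, Step L (c i) (c (i + 1))) :
    Set.InjOn c {i | i ≤ m} := by
  -- tails strictly decrease in length along the chain
  have hmono : ∀ i j, i < j → j ≤ m → (ltail (c j) L).length < (ltail (c i) L).length := by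
    intro i j hij hjm
    induction j with
    | zero => exact absurd hij (Nat.not_lt_zero i)
    | succ j ih =>
      have hs := hstep j (by omega)
      have hlt := length_ltail_lt_of_mem_ltail hs.mem
      by_cases hij' : i < j
      · exact hlt.trans (ih hij' (by omega))
      · have : i = j := by omega
        subst this
        exact hlt
  intro i hi j hj hij
  by_contra hne
  rcases Nat.lt_or_gt_of_ne hne with h | h
  · have := hmono i j h hj
    rw [hij] at this
    exact lt_irrefl _ this
  · have := hmono j i h hi
    rw [hij] at this
    exact lt_irrefl _ this

end Semantic

end ResLinSW

end Summit.PneNP.PneNP.Theorems
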